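import Literature.AlgebraicGeometry.HodgeTheory.WeilClassesFourfolds
import Literature.AlgebraicGeometry.Motives.AbelianVarietyImage
import Literature.AlgebraicGeometry.HodgeTheory.GysinFormalism
import Literature.Barriers.HodgeConjecture.ExceptionalHodgeClasses
import HarnessLib

/-!
# Moonen–Zarhin 1999, Thms. 0.1 and 0.2: codimension-2 Hodge classes on abelian fourfolds and fivefolds

Topic `Literature/AlgebraicGeometry/HodgeTheory`. TWO named facts (D-0014), no proofs, vendored
VERBATIM from the hypothesis binders `h01`, `h02` of the accepted reductions
`MoonenZarhin1999_hodgeClasses_abelian_dim_le_five_of_weilClassesFourfolds_of_printed` /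
`…_of_serreGAGA_printed` (`AbelianLowDimensionWeilReductionProofs.lean`, p112666) — librarian sweep
g24, vend-from-binder, promote events 3370544 / 3370798 (the provefact seat may not mint them,
`lint.fact-fanout`; 21 re-seatings). First consumer: those reductions, whence
`MoonenZarhin1999_hodgeClasses_abelian_dim_le_five_of_weilClassesFourfolds_holds :=
  …_of_printed MoonenZarhin1999_codimTwoHodgeClasses_abelianFourfold_holds
    MoonenZarhin1999_codimTwoHodgeClasses_abelianFivefold_holds` the day both are proved.

## Source and reading

B. Moonen, Yu. Zarhin, *Hodge classes on abelian varieties of low dimension*, Math. Ann. 315 (1999)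
711–733 (arXiv:math/9901113). Thm. 0.1: for a complex abelian FOURFOLD `X`, the space of Hodge
classes is generated by divisor classes and Weil classes: in codimension 2,
`B²(X) ⊆ D²(X) + Σ_k W_k`, where `D²` is spanned by products of divisor classes and the `W_k` are the
spaces of Weil classes `weilClassesOf X φ 2 d` attached to the endomorphisms `φ` with `φ² = −d`
(multiplication by an imaginary quadratic field `ℚ(√−d)` acting on `X`), (1.4)–(1.9). Thm. 0.2: for
an abelian FIVEFOLD `X`, `B²(X) ⊆ D²(X) + Σ_α α^* B²(X')` over the surjective homomorphisms
`α : X ↠ X'` onto abelian fourfolds, parts (i)–(iv), proved in §5 (5.6)–(5.12) (Hodge groups of all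
fivefolds in (5.6)–(5.11), Hodge rings of the cases (e), (f), (g) and part (iv) in (5.12); the
paper has no item (2.8) — §2 ends with Tankeev's Thm. (2.7), and the "Lemma 2.8" quoted inside
(5.11) is Moonen–Zarhin 1995, Duke 77). Here `Bᵖ` = rational classes of Hodge
type `(p,p)` (`IsRationalClass`, `IsOfHodgeType … p p`), `D²` = `divisorClassesSpan X.X X.dim 2`
(`Barriers/HodgeConjecture/ExceptionalHodgeClasses.lean`), Weil classes = `weilClassesOf`
(`HodgeTheory/WeilClasses.lean`), pull-back = `complexBetti.map α`.

What is deliberately NOT here: the general statement of Thms. 0.1/0.2 in all codimensions (only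
the codimension-2 parts enter Markman's combination), and the exceptional classes of §§3–4.
-/

noncomputable section

open CategoryTheory AlgebraicGeometry

namespace Literature.AlgebraicGeometry.HodgeTheory

open Literature.AlgebraicTopology.SingularHomology
open Literature.AlgebraicGeometry.Motives
open Literature.Barriers.HodgeConjecture

/-- **Moonen–Zarhin 1999, Thm. 0.1, codimension-2 part (abelian fourfolds).** For a complex abelian
variety `A` of dimension `4`, every rational Hodge class `c ∈ H⁴(A, ℂ)` of type `(2,2)` lies in
the span of the products of divisor classes (`divisorClassesSpan A.X A.dim 2`) and of the rational
`(2,2)` Weil classes `w ∈ weilClassesOf A φ 2 d` attached to the endomorphisms `φ : A ⟶ A` with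
`φ ≫ φ = −d` (`0 < d`): "`B²(X) = D²(X) + Σ W_K`" (Thm. 0.1 with (1.4), (1.9)). VERBATIM the binder
`h01` of `MoonenZarhin1999_hodgeClasses_abelian_dim_le_five_of_weilClassesFourfolds_of_printed`;
users take `(h : MoonenZarhin1999_codimTwoHodgeClasses_abelianFourfold)`. Named fact (D-0014),
not proved in the tree.
[cite: MoonenZarhin1999LowDim, Thm. 0.1 with (1.4) and (1.9); arXiv:math/9901113] -/
def MoonenZarhin1999_codimTwoHodgeClasses_abelianFourfold : Prop :=
  ∀ A : AbelianVariety ℂ, A.dim = 4 →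
    ∀ c : complexBetti A.X (2 * 2), IsRationalClass c → IsOfHodgeType A.dim A.X (2 * 2) 2 2 c →
      c ∈ divisorClassesSpan A.X A.dim 2 ⊔
        Submodule.span ℂ {w : complexBetti A.X (2 * 2) | ∃ (d : ℕ) (φ : A ⟶ A), 0 < d ∧
          φ ≫ φ = -(d • 𝟙 A) ∧ IsRationalClass w ∧ IsOfHodgeType A.dim A.X (2 * 2) 2 2 w ∧
          w ∈ weilClassesOf A φ 2 d}

/-- **Moonen–Zarhin 1999, Thm. 0.2, codimension-2 part (abelian fivefolds).** For a complex abelian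
variety `A` of dimension `5`, every rational Hodge class `c ∈ H⁴(A, ℂ)` of type `(2,2)` lies in
the span of the products of divisor classes and of the pull-backs `complexBetti.map α (2*2) w` of
rational `(2,2)` classes `w` on abelian FOURFOLDS `B` along the surjective homomorphisms
`α : A ⟶ B` (`Surjective` = `AlgebraicGeometry.Surjective`, the morphism property):
"`B²(X) = D²(X) + Σ_α α^* B²(X')`" (Thm. 0.2 (i)–(iv) with (1.4), (1.9); §5 (5.12)). VERBATIM the
binder `h02` of `MoonenZarhin1999_hodgeClasses_abelian_dim_le_five_of_weilClassesFourfolds_of_printed`;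
users take `(h : MoonenZarhin1999_codimTwoHodgeClasses_abelianFivefold)`. Named fact (D-0014), not
proved in the tree.
[cite: MoonenZarhin1999LowDim, Thm. 0.2 (i)–(iv) with (1.4) and (1.9), §5 (5.6)–(5.12); arXiv:math/9901113v2 pp. 2–3, 17–19] -/
def MoonenZarhin1999_codimTwoHodgeClasses_abelianFivefold : Prop :=
  ∀ A : AbelianVariety ℂ, A.dim = 5 →
    ∀ c : complexBetti A.X (2 * 2), IsRationalClass c → IsOfHodgeType A.dim A.X (2 * 2) 2 2 c →
      c ∈ divisorClassesSpan A.X A.dim 2 ⊔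
        Submodule.span ℂ {w' : complexBetti A.X (2 * 2) |
          ∃ (B : AbelianVariety ℂ) (α : A ⟶ B) (w : complexBetti B.X (2 * 2)),
            B.dim = 4 ∧ Surjective (AbelianVariety.Hom.toSchemeHom α) ∧
            IsRationalClass w ∧ IsOfHodgeType B.dim B.X (2 * 2) 2 2 w ∧
            w' = complexBetti.map α.hom.hom.hom (2 * 2) w}

end Literature.AlgebraicGeometry.HodgeTheory

end
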